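import Mathlib.Analysis.Normed.Group.Ultra
import Mathlib.Analysis.Normed.Module.FiniteDimension
import Mathlib.Analysis.Normed.Unbundled.SpectralNorm
import Mathlib.FieldTheory.Minpoly.IsIntegrallyClosed
import Mathlib.NumberTheory.Cyclotomic.PrimitiveRoots
import Mathlib.RingTheory.Artinian.Ring
import Mathlib.RingTheory.Discriminant
import Mathlib.RingTheory.Ideal.Quotient.Nilpotent
import Mathlib.RingTheory.IntegralClosure.IntegrallyClosed
import Mathlib.RingTheory.IsAdjoinRoot
import Mathlib.RingTheory.Norm.Transitivity
import Mathlib.RingTheory.RootsOfUnity.AlgebraicallyClosed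
import Mathlib.RingTheory.Valuation.LocalSubring
import Mathlib.Topology.Algebra.Valued.NormedValued
import Mathlib.Topology.Instances.Matrix
import Literature.NumberTheory.GaloisRepresentations.LocalExistenceTheorem
import HarnessLib

/-!
# The existence theorem of local class field theory — proofs of the elementary inputs

Companion to `Literature/NumberTheory/GaloisRepresentations/LocalExistenceTheorem.lean`
(Serre, *Local Fields*, XI §4–5, XIV §6), which reduces the existence theorem
`Literature.NumberTheory.GaloisRepresentations.localExistenceTheorem` (= the trunk fact `exists_intermediateField_normSubgroup_eq` with
its local-field binders restored) to six named facts `h₁ … h₆`.  This file **proves** the two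
facts that do not depend on the reciprocity law, and re-assembles:

* `Literature.NumberTheory.GaloisRepresentations.isClosed_of_isNormSubgroup_holds` — axiom III-1 of Serre XIV §6: **norm groups are
  closed** (`h₄`);
* `Literature.NumberTheory.GaloisRepresentations.exists_isNormSubgroup_le_of_unitGroup_le` — axiom III-3 in the weak form that suffices:
  **every finite-index subgroup of `Fˣ` containing `𝒪_Fˣ` contains a norm group**, namely the
  norm group of the unramified (cyclotomic) extension `F(ζ_{q^r-1})`; the printed III-3
  (`h₅ = isNormSubgroup_of_unitGroup_le`, "is a norm group") is this plus `h₂`;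
* `Literature.NumberTheory.GaloisRepresentations.localExistenceTheorem_of_reciprocity` — the existence theorem from the four remaining
  facts `h₁ h₂ h₃ h₆` only (norm groups stable under `⊓` and over-groups, universal norms are
  `n`-th powers, norm index = degree), i.e. from the reciprocity-law block of local class field
  theory and Serre's XI §5 Prop. 6.

## Proofs

**III-1.**  Serre (XIV §6): `N_{E/F}⁻¹(U_F) = U_E` is compact, so `N` is proper with closed
image.  We run this with Mathlib's spectral norm in place of the valuation of `E`: for a finite
extension `E/F` of a non-archimedean local field, `spectralNorm F E` is a multiplicative
ultrametric norm (`spectralNorm.normedField`; `F` is complete), `‖N_{E/F} x‖ = ‖x‖^{[E:F]}`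
(`norm_algebraNorm_eq_spectralNorm_pow`, Serre II §2 Cor. 4), `N` is continuous and the unit
sphere of `E` is compact (`E` is proper), so `N(Eˣ) ∩ 𝒪_Fˣ = N({‖x‖ = 1})` is compact; and a
subgroup whose trace on an open subgroup is closed is closed
(`Subgroup.isClosed_of_isOpen_of_isClosed_inf`).

**III-3 (weak).**  For `K` complete non-archimedean with valuation ring `R`, residue field `k`,
and `L = K(ζ_m)` with `‖m‖ = 1` (Serre IV §4 Prop. 16): the integral closure `O` of `R` in `L`
is `{‖·‖ ≤ 1}` (spectral norm), a local ring; the discriminant of `1, ζ, …, ζ^{d-1}` is a unit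
(`X^m - 1 = G H`, `G'(ζ)H(ζ) = mζ^{m-1}`), so `O = R[ζ]` (`Algebra.discr_mul_isIntegral_mem_adjoin`);
hence `O/𝔪_R O ≅ k[X]/(Ḡ)` is reduced (`Ḡ ∣ X^m-1` squarefree), local and Artinian, so a field:
`𝔪_R O = 𝔪_O` (**`e = 1`**), and `m ∣ q^{[L:K]} - 1` (the residue field has `q^{[L:K]}`
elements and a primitive `m`-th root of unity; Cor. 1 to Prop. 16 in weak form).  If `𝔪_R = (π)`
then every `x ∈ Lˣ` is `πⁿu` with `‖u‖ = 1`, so `N x = (πⁿ)^{[L:K]} · N u` with `‖N u‖ = 1`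
(II §2 Cor. 4).  For a local `F` and `r ≥ 1` take `m = q^r - 1`: then `r ∣ [E:F]`
(`Nat.pow_sub_one_gcd_pow_sub_one`) and `N(Eˣ) ⊆ (Fˣ)^r · 𝒪_Fˣ ⊆ U` for any `U ⊇ 𝒪_Fˣ` of
index `r`.

**Assembly.**  As in Serre XI §5 Thm. 2 (`localExistenceTheorem_of`), except that the closed
finite-index subgroup `V = 𝒪ˣ·(N₀ ∩ U) ⊇ 𝒪ˣ` is only known to *contain* a norm group `V'`;
then `N₀ ∩ V' ⊆ N₀ ∩ V ⊆ U` and `N₀ ∩ V'` is a norm group (`h₁`), so `U` is one (`h₂`).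

## References

* J.-P. Serre, *Local Fields*, GTM 67, Springer 1979: Ch. II §2 Prop. 3 and Cor. 2, 4
  (pp. 28–29); Ch. IV §4 Prop. 16, Cor. 1 (pp. 77–78); Ch. V §2 Prop. 3 (p. 82); Ch. XI §4
  Prop. 4, §5 Prop. 6, Thm. 2 (pp. 172–175); Ch. XIV §6 Thm. 1 and its proof, axioms III-1,
  III-3 (pp. 218–219).  [SerreLocalFields1979]

## Mathlib reuse

`spectralNorm`, `spectralNorm.normedField`, `spectralNorm.spectralNorm_eq_norm_coeff_zero_rpow`,
`spectralValue_le_one_iff`, `Algebra.norm_eq_norm_adjoin`, `FiniteDimensional.proper`,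
`Valued.toNontriviallyNormedField`, `Algebra.discr_powerBasis_eq_norm`,
`Algebra.discr_mul_isIntegral_mem_adjoin`, `minpoly.equivAdjoin`, `AdjoinRoot.quotEquivQuotMap`,
`IsArtinianRing.isField_of_isReduced_of_isLocalRing`, `IsCyclotomicExtension.isAbelianGalois`,
`HasEnoughRootsOfUnity`, `Nat.pow_sub_one_gcd_pow_sub_one`, `IsDiscreteValuationRing 𝒪[F]`.
-/

noncomputable section

open ValuativeRel Polynomial
open scoped Pointwise

/-! ### A closedness criterion for subgroups of topological groups -/

/-- A subgroup `H` of a topological group whose intersection with some *open* subgroup `K` is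
closed is itself closed: if `x ∈ closure H` then the neighbourhood `xK` meets `H` in some `h`,
and `x ∈ closure (H ∩ hK) = closure (h • (H ⊓ K)) = h • (H ⊓ K) ⊆ H`. [folklore] -/
theorem Subgroup.isClosed_of_isOpen_of_isClosed_inf {G : Type*} [Group G]
    [TopologicalSpace G] [ContinuousMul G] (H K : Subgroup G) (hK : IsOpen (K : Set G))
    (hHK : IsClosed ((H ⊓ K : Subgroup G) : Set G)) : IsClosed (H : Set G) := by
  refine isClosed_of_closure_subset fun x hx => ?_
  have hxK : x • (K : Set G) ∈ nhds x := (hK.smul x).mem_nhds ⟨1, K.one_mem, by simp⟩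
  obtain ⟨_, ⟨k, hk, rfl⟩, hhH⟩ := mem_closure_iff_nhds.mp hx _ hxK
  simp only [smul_eq_mul, SetLike.mem_coe] at hhH
  have hx' : x ∈ _root_.closure ((x * k) • (K : Set G) ∩ (H : Set G)) :=
    (hK.smul (x * k)).inter_closure ⟨⟨k⁻¹, K.inv_mem hk, by simp [smul_eq_mul]⟩, hx⟩
  have heq : (x * k) • (K : Set G) ∩ (H : Set G) = (x * k) • ((H ⊓ K : Subgroup G) : Set G) := by
    ext y
    constructor
    · rintro ⟨⟨k', hk', rfl⟩, hyH⟩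
      refine ⟨k', Subgroup.mem_inf.mpr ⟨?_, hk'⟩, rfl⟩
      simpa only [smul_eq_mul, inv_mul_cancel_left] using H.mul_mem (H.inv_mem hhH) hyH
    · rintro ⟨k', ⟨hk'H, hk'K⟩, rfl⟩
      exact ⟨⟨k', hk'K, rfl⟩, H.mul_mem hhH hk'H⟩
  rw [heq, (hHK.smul (x * k)).closure_eq] at hx'
  obtain ⟨k', ⟨hk'H, -⟩, hk'x⟩ := hx'
  rw [← hk'x]
  exact H.mul_mem hhH hk'H

namespace Literature.NumberTheory.GaloisRepresentations

/-! ### The spectral norm on a finite extension of a complete non-archimedean field -/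

section Spectral

variable (K : Type*) [NontriviallyNormedField K] [CompleteSpace K] [IsUltrametricDist K]
  (L : Type*) [Field L] [Algebra K L] [Algebra.IsAlgebraic K L]

omit [CompleteSpace K] [IsUltrametricDist K] in
/-- **The integral closure is the unit ball of the spectral norm.**  For an algebraic extension
`L` of a nontrivially normed field `K` with valuation ring `R = {‖·‖ ≤ 1}`, `x ∈ L` is integral
over `R` iff `spectralNorm K L x ≤ 1` (both say the minimal polynomial of `x` has coefficients
in `R`; cf. `Literature.NumberTheory.GaloisRepresentations.mem_absIntegers_iff_spectralNorm_le_one` for `L = K̄`).  Serre LF II §2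
Prop. 3 (the integral closure `B` of `A` in `L` is the valuation ring of the extended
valuation); Neukirch ANT II (4.8). [cite: SerreLocalFields1979, Ch. II §2 Prop. 3] -/
theorem mem_integralClosure_iff_spectralNorm_le_one (R : ValuationSubring K)
    (hR : ∀ x : K, x ∈ R ↔ ‖x‖ ≤ 1) {x : L} :
    x ∈ integralClosure R L ↔ spectralNorm K L x ≤ 1 := by
  have hxi : IsIntegral K x := Algebra.IsIntegral.isIntegral x
  rw [mem_integralClosure_iff, spectralNorm, spectralValue_le_one_iff (minpoly.monic hxi)]
  constructor
  · intro hx n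
    rw [minpoly.isIntegrallyClosed_eq_field_fractions' K hx, coeff_map]
    exact (hR _).mp (SetLike.coe_mem _)
  · intro h
    have hl : minpoly K x ∈ lifts (algebraMap R K) := by
      rw [lifts_iff_coeff_lifts]
      intro n
      exact ⟨⟨_, (hR _).mpr (h n)⟩, rfl⟩
    obtain ⟨q, hq, -, hqm⟩ := lifts_and_natDegree_eq_and_monic hl (minpoly.monic hxi)
    refine ⟨q, hqm, ?_⟩
    rw [← aeval_def, ← aeval_map_algebraMap K, hq]
    exact minpoly.aeval K x

variable [FiniteDimensional K L]

/-- `‖N_{L/K}(x)‖ = (spectral norm of x) ^ [L : K]` for a finite extension `L` of a complete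
non-archimedean field `K` (Serre LF II §2, Cor. 4 to Prop. 3: `w(x) = (1/f) v(N x)`, i.e.
`|x|_L = |N x|_K^{1/n}`).  Proof: `spectralNorm x = ‖a₀‖ ^ (1/d)` with `a₀, d` the constant
coefficient and degree of the minimal polynomial, `N_{K(x)/K}(x) = ± a₀`, and
`N_{L/K} x = N_{K(x)/K}(x)^{[L:K(x)]}`. [cite: SerreLocalFields1979, Ch. II §2 Cor. 4] -/
theorem norm_algebraNorm_eq_spectralNorm_pow (x : L) :
    ‖Algebra.norm K x‖ = spectralNorm K L x ^ Module.finrank K L := by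
  have hx : IsIntegral K x := Algebra.IsIntegral.isIntegral x
  have hd : (minpoly K x).natDegree ≠ 0 := (minpoly.natDegree_pos hx).ne'
  have h2 : spectralNorm K L x ^ (minpoly K x).natDegree = ‖(minpoly K x).coeff 0‖ := by
    rw [spectralNorm.spectralNorm_eq_norm_coeff_zero_rpow K L x, one_div,
      Real.rpow_inv_natCast_pow (norm_nonneg _) hd]
  have h3 : Algebra.norm K (IntermediateField.AdjoinSimple.gen K x) =
      (-1) ^ (minpoly K x).natDegree * (minpoly K x).coeff 0 := by
    have := Algebra.PowerBasis.norm_gen_eq_coeff_zero_minpoly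
      (IntermediateField.adjoin.powerBasis hx)
    rwa [IntermediateField.adjoin.powerBasis_gen, IntermediateField.adjoin.powerBasis_dim,
      IntermediateField.minpoly_gen] at this
  rw [Algebra.norm_eq_norm_adjoin K x, norm_pow, h3, norm_mul, norm_pow, norm_neg, norm_one,
    one_pow, one_mul, ← h2, ← pow_mul, ← IntermediateField.adjoin.finrank hx,
    Module.finrank_mul_finrank]

/-- `‖N_{L/K} x‖ ≤ 1` when the spectral norm of `x` is `≤ 1`. [folklore] -/
theorem norm_algebraNorm_le_one {x : L} (hx : spectralNorm K L x ≤ 1) :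
    ‖Algebra.norm K x‖ ≤ 1 := by
  rw [norm_algebraNorm_eq_spectralNorm_pow]
  exact pow_le_one₀ (spectralNorm_nonneg x) hx

/-- The norm map `N_{L/K} : L → K` of a finite extension is continuous for the spectral norm
topology on `L` (it is the determinant of the `K`-linear left-multiplication matrix).
[folklore] -/
theorem continuous_algebraNorm :
    letI := spectralNorm.normedField K L
    Continuous (Algebra.norm K : L → K) := by
  letI := spectralNorm.normedField K L
  letI : NormedSpace K L := spectralNorm.normedSpace K L
  classical
  let b := Module.Free.chooseBasis K L
  have hc : Continuous (Algebra.leftMulMatrix b : L → Matrix _ _ K) :=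
    (Algebra.leftMulMatrix b).toLinearMap.continuous_of_finiteDimensional
  have : (Algebra.norm K : L → K) = fun x => (Algebra.leftMulMatrix b x).det := by
    funext x
    exact Algebra.norm_eq_matrix_det b x
  rw [this]
  exact hc.matrix_det

/-- Over a locally compact complete non-archimedean field, the spectral unit sphere
`{x : L | ‖x‖ = 1}` of a finite extension `L` is compact (`L` is a proper space, being a
finite-dimensional normed space over a locally compact field).  This is the compactness of
the unit group `U_L` used in Serre LF XIV §6, III-1. [folklore] -/
theorem isCompact_sphere_spectralNorm [LocallyCompactSpace K] :
    letI := spectralNorm.normedField K L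
    IsCompact (Metric.sphere (0 : L) 1) := by
  letI := spectralNorm.normedField K L
  letI : NormedSpace K L := spectralNorm.normedSpace K L
  haveI : ProperSpace L := FiniteDimensional.proper K L
  exact isCompact_sphere 0 1

omit [FiniteDimensional K L] in
/-- Units of the integral closure `O = {‖·‖ ≤ 1}` are the elements of spectral norm one
(Serre LF II §2 Prop. 3: `B` is the valuation ring of `w`). [cite: SerreLocalFields1979, Ch. II §2 Prop. 3] -/
theorem isUnit_integralClosure_iff (R : ValuationSubring K) (hR : ∀ x : K, x ∈ R ↔ ‖x‖ ≤ 1)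
    (z : integralClosure R L) : IsUnit z ↔ spectralNorm K L z = 1 := by
  letI := spectralNorm.normedField K L
  have hO : ∀ y : L, y ∈ integralClosure R L ↔ ‖y‖ ≤ 1 := fun y =>
    mem_integralClosure_iff_spectralNorm_le_one K L R hR
  change IsUnit z ↔ ‖(z : L)‖ = 1
  constructor
  · rintro ⟨u, rfl⟩
    have h1 : ‖((u : integralClosure R L) : L)‖ ≤ 1 := (hO _).mp (SetLike.coe_mem _)
    have h2 : ‖((u⁻¹ : (integralClosure R L)ˣ) : L)‖ ≤ 1 := (hO _).mp (SetLike.coe_mem _)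
    have h3 : ‖((u : integralClosure R L) : L)‖ * ‖((u⁻¹ : (integralClosure R L)ˣ) : L)‖ = 1 := by
      rw [← norm_mul, ← Subalgebra.coe_mul, ← Units.val_mul, mul_inv_cancel, Units.val_one,
        Subalgebra.coe_one, norm_one]
    refine le_antisymm h1 ?_
    calc (1 : ℝ) = _ := h3.symm
      _ ≤ ‖((u : integralClosure R L) : L)‖ * 1 := by gcongr
      _ = _ := mul_one _
  · intro hz
    have hz0 : (z : L) ≠ 0 := by
      intro h
      rw [h, norm_zero] at hz
      exact zero_ne_one hz
    have hinv : (z : L)⁻¹ ∈ integralClosure R L := by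
      rw [hO, norm_inv, hz, inv_one]
    refine IsUnit.of_mul_eq_one ⟨_, hinv⟩ (Subtype.ext ?_)
    change (z : L) * (z : L)⁻¹ = 1
    exact mul_inv_cancel₀ hz0

omit [FiniteDimensional K L] in
/-- The integral closure `O = {‖·‖ ≤ 1}` of the valuation ring in an algebraic extension is a
local ring, with maximal ideal `{‖·‖ < 1}` (Serre LF II §2 Prop. 3: `B` is a discrete
valuation ring; here only locality is recorded). [cite: SerreLocalFields1979, Ch. II §2 Prop. 3] -/
theorem isLocalRing_integralClosure (R : ValuationSubring K) (hR : ∀ x : K, x ∈ R ↔ ‖x‖ ≤ 1) :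
    IsLocalRing (integralClosure R L) := by
  letI := spectralNorm.normedField K L
  have hO : ∀ y : L, y ∈ integralClosure R L ↔ ‖y‖ ≤ 1 := fun y =>
    mem_integralClosure_iff_spectralNorm_le_one K L R hR
  have hu : ∀ z : integralClosure R L, z ∈ nonunits _ ↔ ‖(z : L)‖ < 1 := fun z => by
    rw [mem_nonunits_iff, isUnit_integralClosure_iff K L R hR,
      show spectralNorm K L z = ‖(z : L)‖ from rfl]
    constructor
    · intro h
      exact lt_of_le_of_ne ((hO _).mp z.2) h
    · intro h
      exact h.ne
  refine IsLocalRing.of_nonunits_add fun a b ha hb => ?_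
  rw [hu] at ha hb ⊢
  rw [Subalgebra.coe_add]
  exact (isNonarchimedean_spectralNorm (a : L) (b : L)).trans_lt (max_lt ha hb)

omit [FiniteDimensional K L] in
/-- The maximal ideal of `O = {‖·‖ ≤ 1}` is `{‖·‖ < 1}`. [folklore] -/
theorem mem_maximalIdeal_integralClosure_iff (R : ValuationSubring K)
    (hR : ∀ x : K, x ∈ R ↔ ‖x‖ ≤ 1) (z : integralClosure R L) :
    haveI := isLocalRing_integralClosure K L R hR
    z ∈ IsLocalRing.maximalIdeal (integralClosure R L) ↔ spectralNorm K L z < 1 := by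
  haveI := isLocalRing_integralClosure K L R hR
  rw [IsLocalRing.mem_maximalIdeal, mem_nonunits_iff, isUnit_integralClosure_iff K L R hR]
  constructor
  · intro h
    exact lt_of_le_of_ne ((mem_integralClosure_iff_spectralNorm_le_one K L R hR).mp z.2) h
  · intro h
    exact h.ne

end Spectral

/-! ### Norm groups are closed (Serre LF XIV §6, axiom III-1) -/

section Closed

open scoped Valued in
/-- For a finite extension `E` of a non-archimedean local field `F`, the norm group
`N_{E/F}(Eˣ) ≤ Fˣ` is closed.  Serre LF XIV §6 (proof of Thm. 1, III-1): `N⁻¹(U_F) = U_E` is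
compact; here `N(Eˣ) ∩ 𝒪_Fˣ = N({‖x‖ = 1})` is a continuous image of the compact spectral unit
sphere, and `𝒪_Fˣ` is open in `Fˣ`, so `Subgroup.isClosed_of_isOpen_of_isClosed_inf` applies.
[cite: SerreLocalFields1979, Ch. XIV §6 Thm. 1 (proof, axiom III-1)] -/
theorem isClosed_range_unitsMap_algebraNorm (F : Type*) [Field F] [ValuativeRel F]
    [TopologicalSpace F] [IsNonarchimedeanLocalField F] (E : Type*) [Field E] [Algebra F E]
    [FiniteDimensional F E] :
    IsClosed ((Units.map (Algebra.norm F : E →* F)).range : Set Fˣ) := by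
  letI : UniformSpace F := IsTopologicalAddGroup.rightUniformSpace F
  haveI : IsUniformAddGroup F := isUniformAddGroup_of_addCommGroup
  letI hv1 : (Valued.v (R := F)).RankOne :=
  { hom' := IsRankLeOne.nonempty.some.emb (R := F).comp MonoidWithZeroHom.ValueGroup₀.embedding
    strictMono' := IsRankLeOne.nonempty.some.strictMono.comp
        MonoidWithZeroHom.ValueGroup₀.embedding_strictMono }
  letI hNF : NontriviallyNormedField F := Valued.toNontriviallyNormedField F (ValueGroupWithZero F)
  have hn1 : ∀ y : F, ‖y‖ = 1 ↔ valuation F y = 1 := fun y => by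
    rw [le_antisymm_iff, le_antisymm_iff, Valued.toNormedField.norm_le_one_iff,
      Valued.toNormedField.one_le_norm_iff]
    rfl
  letI := spectralNorm.normedField F E
  set N : Subgroup Fˣ := (Units.map (Algebra.norm F : E →* F)).range with hN_def
  set O : Subgroup Fˣ := (valuation F).valuationSubring.unitGroup with hO_def
  have hO : IsOpen (O : Set Fˣ) := by
    have : (O : Set Fˣ) = Units.val ⁻¹' {y : F | (valuation F).restrict y = 1} := by
      ext u
      simp only [hO_def, SetLike.mem_coe, Valuation.mem_unitGroup_iff, Set.mem_preimage,
        Set.mem_setOf_eq, Valuation.restrict_eq_one_iff]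
    rw [this]
    exact (Valuation.isOpen_sphere (v := valuation F) one_ne_zero).preimage Units.continuous_val
  have hT : IsClosed ((Algebra.norm F) '' Metric.sphere (0 : E) 1) :=
    ((isCompact_sphere_spectralNorm F E).image (continuous_algebraNorm F E)).isClosed
  have hn0 : Module.finrank F E ≠ 0 := Module.finrank_pos.ne'
  have hNO : ((N ⊓ O : Subgroup Fˣ) : Set Fˣ) =
      Units.val ⁻¹' ((Algebra.norm F) '' Metric.sphere (0 : E) 1) := by
    ext u
    simp only [Subgroup.coe_inf, Set.mem_inter_iff, SetLike.mem_coe, hN_def, hO_def,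
      MonoidHom.mem_range, Set.mem_preimage, Set.mem_image, Metric.mem_sphere, dist_zero_right,
      Valuation.mem_unitGroup_iff]
    constructor
    · rintro ⟨⟨x, rfl⟩, hu⟩
      refine ⟨(x : E), ?_, rfl⟩
      have h1 : ‖Algebra.norm F (x : E)‖ = 1 := (hn1 _).mpr (by simpa using hu)
      rw [norm_algebraNorm_eq_spectralNorm_pow F E, pow_eq_one_iff_of_nonneg
        (spectralNorm_nonneg _) hn0] at h1
      exact h1
    · rintro ⟨x, hx1, hxu⟩
      have hx0 : x ≠ 0 := by
        rintro rfl
        simp at hx1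
      refine ⟨⟨Units.mk0 x hx0, Units.ext (by simpa using hxu)⟩, ?_⟩
      rw [← hxu, ← hn1, norm_algebraNorm_eq_spectralNorm_pow F E,
        show spectralNorm F E x = ‖x‖ from rfl, hx1, one_pow]
  exact N.isClosed_of_isOpen_of_isClosed_inf O hO (hNO ▸ hT.preimage Units.continuous_val)

/-- Norm groups (of finite abelian `E ⊆ F̄`) of a non-archimedean local field are closed.
[cite: SerreLocalFields1979, Ch. XIV §6 Thm. 1 (proof, axiom III-1)] -/
theorem IsNormSubgroup.isClosed {F : Type*} [Field F] [ValuativeRel F] [TopologicalSpace F]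
    [IsNonarchimedeanLocalField F] {U : Subgroup Fˣ} (hU : IsNormSubgroup F U) :
    IsClosed (U : Set Fˣ) := by
  obtain ⟨E, hfd, -, rfl⟩ := hU
  exact isClosed_range_unitsMap_algebraNorm F E

/-- **Discharge of the named fact `isClosed_of_isNormSubgroup`** (Serre LF XIV §6, proof of
Thm. 1, axiom III-1): every norm group of a non-archimedean local field is closed.
[cite: SerreLocalFields1979, Ch. XIV §6 Thm. 1 (proof, axiom III-1)] -/
theorem isClosed_of_isNormSubgroup_holds (F : Type*) [Field F] [ValuativeRel F]
    [TopologicalSpace F] [IsNonarchimedeanLocalField F] : isClosed_of_isNormSubgroup F :=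
  fun _ hU => hU.isClosed

end Closed

/-! ### Cyclotomic unramified extensions (Serre LF IV §4 Prop. 16) -/

section Cyclotomic

variable (K : Type*) [NontriviallyNormedField K] [CompleteSpace K] [IsUltrametricDist K]
  (L : Type*) [Field L] [Algebra K L] [FiniteDimensional K L]
  (R : ValuationSubring K) (hR : ∀ x : K, x ∈ R ↔ ‖x‖ ≤ 1)
  {m : ℕ} [NeZero m] {ζ : L} (hζ : IsPrimitiveRoot ζ m) [IsCyclotomicExtension {m} K L]
  (hm : ‖(m : K)‖ = 1)

include hζ in
omit [CompleteSpace K] [IsUltrametricDist K] [IsCyclotomicExtension {m} K L]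
  [FiniteDimensional K L] in
/-- A root of unity is integral over the valuation ring. [folklore] -/
theorem isIntegral_zeta : IsIntegral R ζ :=
  IsIntegral.of_pow (NeZero.pos m) (by rw [hζ.pow_eq_one]; exact isIntegral_one)

include hR hm in
omit [CompleteSpace K] [IsUltrametricDist K] [Field L] [Algebra K L] [NeZero m]
  [IsCyclotomicExtension {m} K L] [FiniteDimensional K L] in
/-- `m` is nonzero in the residue field `k = R/𝔪_R` when `‖m‖ = 1` ("`n` prime to `p`" in
Serre LF IV §4 Prop. 16). [folklore] -/
theorem natCast_residue_ne_zero :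
    (m : IsLocalRing.ResidueField R) ≠ 0 := by
  intro h
  rw [← map_natCast (IsLocalRing.residue R), IsLocalRing.residue_eq_zero_iff,
    IsLocalRing.mem_maximalIdeal, mem_nonunits_iff] at h
  apply h
  have hinv : ((m : K))⁻¹ ∈ R := by rw [hR, norm_inv, hm, inv_one]
  have hm0 : (m : K) ≠ 0 := by
    intro h0
    rw [h0, norm_zero] at hm
    exact zero_ne_one hm
  refine IsUnit.of_mul_eq_one ⟨_, hinv⟩ (Subtype.ext ?_)
  change ((m : R) : K) * ((m : K))⁻¹ = 1
  rw [show ((m : R) : K) = (m : K) by simp, mul_inv_cancel₀ hm0]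

include hR in
omit [CompleteSpace K] [IsUltrametricDist K] [Field L] [Algebra K L] [NeZero m]
  [IsCyclotomicExtension {m} K L] [FiniteDimensional K L] hζ in
/-- The maximal ideal of the valuation ring `R = {‖·‖ ≤ 1}` is `{‖·‖ < 1}`. [folklore] -/
theorem mem_maximalIdeal_valuationSubring_iff (r : R) :
    r ∈ IsLocalRing.maximalIdeal R ↔ ‖(r : K)‖ < 1 := by
  rw [IsLocalRing.mem_maximalIdeal, mem_nonunits_iff]
  have hr1 : ‖(r : K)‖ ≤ 1 := (hR _).mp r.2
  constructor
  · intro h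
    refine lt_of_le_of_ne hr1 fun h1 => h ?_
    have hr0 : (r : K) ≠ 0 := by
      intro h0
      rw [h0, norm_zero] at h1
      exact zero_ne_one h1
    have hinv : (r : K)⁻¹ ∈ R := by rw [hR, norm_inv, h1, inv_one]
    refine IsUnit.of_mul_eq_one ⟨_, hinv⟩ (Subtype.ext ?_)
    change (r : K) * (r : K)⁻¹ = 1
    exact mul_inv_cancel₀ hr0
  · rintro h ⟨u, rfl⟩
    have h2 : ‖(((u⁻¹ : Rˣ) : R) : K)‖ ≤ 1 := (hR _).mp (SetLike.coe_mem _)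
    have h3 : ‖((u : R) : K)‖ * ‖(((u⁻¹ : Rˣ) : R) : K)‖ = 1 := by
      rw [← norm_mul]
      have h : ((u : R) * ((u⁻¹ : Rˣ) : R) : R) = 1 := u.mul_inv
      have h' := congrArg (fun r : R => (r : K)) h
      simp only [OneMemClass.coe_one] at h'
      rw [show ((u : R) : K) * (((u⁻¹ : Rˣ) : R) : K) = 1 from h', norm_one]
    exact (mul_lt_one_of_nonneg_of_lt_one_left (norm_nonneg _) h h2).ne h3

include hR hζ hm

/-- **The discriminant of `1, ζ, …, ζ^{d-1}` is a unit** for `L = K(ζ)`, `ζ` a primitive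
`m`-th root of unity with `‖m‖ = 1`: writing `X^m - 1 = G·H` with `G` the minimal polynomial
of `ζ`, `G'(ζ)H(ζ) = m ζ^{m-1}` has norm of absolute value `1`, and both factors have absolute
value `≤ 1`; then `disc = ± N(G'(ζ))`.  This is the computation behind `A_{K_n} = A_K[ζ]` in
Serre LF IV §4 Prop. 16 (there via III §5). [cite: SerreLocalFields1979, Ch. IV §4 Prop. 16] -/
theorem norm_discr_powerBasis_eq_one :
    ‖Algebra.discr K (hζ.powerBasis K).basis‖ = 1 := by
  haveI := IsCyclotomicExtension.isGalois {m} K L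
  letI := spectralNorm.normedField K L
  have hsp : ∀ y : L, spectralNorm K L y = ‖y‖ := fun y => rfl
  have hO : ∀ y : L, y ∈ integralClosure R L ↔ ‖y‖ ≤ 1 := fun y =>
    mem_integralClosure_iff_spectralNorm_le_one K L R hR
  have hζi : IsIntegral R ζ := isIntegral_zeta K L R hζ
  -- `G = minpoly R ζ`, mapping to `minpoly K ζ`, divides `X ^ m - 1`
  set G : R[X] := minpoly R ζ with hG
  have hGK : minpoly K ζ = G.map (algebraMap R K) :=
    minpoly.isIntegrallyClosed_eq_field_fractions' K hζi
  have hGmonic : G.Monic := minpoly.monic hζi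
  have hdvdK : minpoly K ζ ∣ (X ^ m - 1 : K[X]) :=
    minpoly.dvd K ζ (by simp [hζ.pow_eq_one])
  have hdvd : G ∣ (X ^ m - 1 : R[X]) := by
    rw [← Polynomial.map_dvd_map (algebraMap R K) (IsFractionRing.injective R K) hGmonic, ← hGK]
    simpa using hdvdK
  obtain ⟨H, hH⟩ := hdvd
  -- derivative identity: `G'(ζ) H(ζ) = m ζ^(m-1)`
  have hder : aeval ζ (derivative G) * aeval ζ H = m * ζ ^ (m - 1) := by
    have h1 : derivative (X ^ m - 1 : R[X]) = derivative G * H + G * derivative H := by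
      rw [hH, derivative_mul]
    have h2 : aeval ζ G = 0 := minpoly.aeval R ζ
    have h3 := congrArg (aeval ζ) h1
    simp only [derivative_sub, derivative_X_pow, derivative_one, sub_zero, map_mul, map_add,
      aeval_X_pow, h2, zero_mul, add_zero, map_natCast] at h3
    exact h3.symm
  -- norms
  have hζ1 : ‖ζ‖ = 1 := by
    have h := congrArg (‖·‖) hζ.pow_eq_one
    simp only [norm_pow, norm_one] at h
    exact (pow_eq_one_iff_of_nonneg (norm_nonneg ζ) (NeZero.ne m)).mp h
  have hle : ∀ p : R[X], ‖aeval ζ p‖ ≤ 1 := fun p => by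
    rw [← hO]
    exact (Algebra.adjoin_le (Set.singleton_subset_iff.mpr (mem_integralClosure_iff R L |>.mpr hζi)))
      (aeval_mem_adjoin_singleton R ζ)
  have hN1 : ‖Algebra.norm K (aeval ζ (derivative G))‖ ≤ 1 :=
    norm_algebraNorm_le_one K L ((hsp _).symm ▸ hle _)
  have hN2 : ‖Algebra.norm K (aeval ζ H)‖ ≤ 1 :=
    norm_algebraNorm_le_one K L ((hsp _).symm ▸ hle _)
  have hprod : ‖Algebra.norm K (aeval ζ (derivative G))‖ * ‖Algebra.norm K (aeval ζ H)‖ = 1 := by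
    rw [← norm_mul, ← map_mul, hder, map_mul, map_pow, norm_mul, norm_pow,
      show ((m : L)) = algebraMap K L (m : K) by simp, Algebra.norm_algebraMap, norm_pow, hm,
      one_pow, one_mul, norm_algebraNorm_eq_spectralNorm_pow K L, hsp, hζ1, one_pow, one_pow]
  have hN1' : ‖Algebra.norm K (aeval ζ (derivative G))‖ = 1 := by
    refine le_antisymm hN1 ?_
    calc (1 : ℝ) = _ := hprod.symm
      _ ≤ ‖Algebra.norm K (aeval ζ (derivative G))‖ * 1 := by gcongr
      _ = _ := mul_one _
  rw [Algebra.discr_powerBasis_eq_norm, norm_mul, norm_pow, norm_neg, norm_one, one_pow, one_mul,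
    IsPrimitiveRoot.powerBasis_gen, hGK, derivative_map, aeval_map_algebraMap, hN1']


/-- **`A_{K_n} = A_K[ζ]`** (Serre LF IV §4 Prop. 16): the integral closure of the valuation
ring `R` of `K` in `L = K(ζ_m)`, `‖m‖ = 1`, is `R[ζ]` — since `disc(1, ζ, …) · z ∈ R[ζ]` for
every integral `z` (`Algebra.discr_mul_isIntegral_mem_adjoin`) and the discriminant is a unit.
[cite: SerreLocalFields1979, Ch. IV §4 Prop. 16] -/
theorem integralClosure_eq_adjoin :
    integralClosure R L = Algebra.adjoin R {ζ} := by
  haveI := IsCyclotomicExtension.isGalois {m} K L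
  have hζi : IsIntegral R ζ := isIntegral_zeta K L R hζ
  refine le_antisymm ?_ (Algebra.adjoin_le (Set.singleton_subset_iff.mpr
    (mem_integralClosure_iff R L |>.mpr hζi)))
  intro z hz
  set δ : K := Algebra.discr K (hζ.powerBasis K).basis with hδ
  have hδ1 : ‖δ‖ = 1 := norm_discr_powerBasis_eq_one K L R hR hζ hm
  have hδ0 : δ ≠ 0 := by
    intro h
    rw [h, norm_zero] at hδ1
    exact zero_ne_one hδ1
  have hmem : δ • z ∈ Algebra.adjoin R {ζ} := by
    have := Algebra.discr_mul_isIntegral_mem_adjoin (K := K) (B := hζ.powerBasis K)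
      (by rw [IsPrimitiveRoot.powerBasis_gen]; exact hζi) (mem_integralClosure_iff R L |>.mp hz)
    rwa [IsPrimitiveRoot.powerBasis_gen] at this
  have hinv : δ⁻¹ ∈ R := by
    rw [hR, norm_inv, hδ1, inv_one]
  have : z = (⟨δ⁻¹, hinv⟩ : R) • (δ • z) := by
    rw [Algebra.smul_def, Algebra.smul_def, IsScalarTower.algebraMap_apply R K L, ← mul_assoc,
      ← map_mul]
    change z = algebraMap K L (δ⁻¹ * δ) * z
    rw [inv_mul_cancel₀ hδ0, map_one, one_mul]
  rw [this]
  exact Subalgebra.smul_mem _ hmem _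

/-- The residue algebra `k[X]/(Ḡ)` of `O = R[ζ]`, `Ḡ` the reduction of the minimal polynomial
of `ζ`, is a field: it is reduced (`Ḡ ∣ X^m - 1` is squarefree as `m ≠ 0` in `k`), local (a
quotient of the local ring `O`) and Artinian.  Equivalently `Ḡ` is irreducible and `K(ζ)/K`
has residue field `k(ζ̄) = k_m` (Serre LF IV §4 Prop. 16: "`K_n` … has residue field `k_n`").
[cite: SerreLocalFields1979, Ch. IV §4 Prop. 16] -/
theorem isField_residue_quot :
    IsField ((IsLocalRing.ResidueField R)[X] ⧸
      Ideal.span {(minpoly R ζ).map (IsLocalRing.residue R)}) := by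
  haveI := IsCyclotomicExtension.isGalois {m} K L
  haveI hloc := isLocalRing_integralClosure K L R hR
  letI := spectralNorm.normedField K L
  have hζi : IsIntegral R ζ := isIntegral_zeta K L R hζ
  set O := integralClosure R L with hOdef
  set G : R[X] := minpoly R ζ with hG
  have hGK : minpoly K ζ = G.map (algebraMap R K) :=
    minpoly.isIntegrallyClosed_eq_field_fractions' K hζi
  have hGmonic : G.Monic := minpoly.monic hζi
  have hdvd : G ∣ (X ^ m - 1 : R[X]) := by
    rw [← Polynomial.map_dvd_map (algebraMap R K) (IsFractionRing.injective R K) hGmonic, ← hGK]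
    simpa using minpoly.dvd K ζ (by simp [hζ.pow_eq_one])
  set 𝔪 := IsLocalRing.maximalIdeal R with h𝔪
  set I : Ideal O := 𝔪.map (algebraMap R O) with hI
  have hIle : I ≤ IsLocalRing.maximalIdeal O := by
    rw [hI, Ideal.map_le_iff_le_comap]
    intro r hr
    rw [Ideal.mem_comap, mem_maximalIdeal_integralClosure_iff K L R hR]
    change spectralNorm K L (algebraMap K L (r : K)) < 1
    rw [spectralNorm_extends]
    exact (mem_maximalIdeal_valuationSubring_iff K R hR r).mp hr
  have hItop : I ≠ ⊤ := fun h => IsLocalRing.maximalIdeal.isMaximal O |>.ne_top (top_le_iff.mp (h ▸ hIle))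
  haveI : Nontrivial (O ⧸ I) := Ideal.Quotient.nontrivial_iff.mpr hItop
  haveI : IsLocalRing (O ⧸ I) := .of_surjective' _ Ideal.Quotient.mk_surjective
  have hOeq : O = Algebra.adjoin R {ζ} := integralClosure_eq_adjoin K L R hR hζ hm
  let e : AdjoinRoot G ≃ₐ[R] O :=
    (minpoly.equivAdjoin hζi).trans (Subalgebra.equivOfEq _ _ hOeq.symm)
  haveI h𝔪max : 𝔪.IsMaximal := IsLocalRing.maximalIdeal.isMaximal R
  set Gbar : (IsLocalRing.ResidueField R)[X] := G.map (IsLocalRing.residue R) with hGbar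
  have hcomp : (e : AdjoinRoot G →+* O).comp (AdjoinRoot.of G) = algebraMap R O :=
    RingHom.ext fun r => e.commutes r
  have hJ : I = (𝔪.map (AdjoinRoot.of G)).map (e : AdjoinRoot G →+* O) := by
    rw [Ideal.map_map, hcomp]
  let q : (O ⧸ I) ≃ₐ[R] ((IsLocalRing.ResidueField R)[X] ⧸ Ideal.span {Gbar}) :=
    (Ideal.quotientEquivAlg (𝔪.map (AdjoinRoot.of G)) I e hJ).symm.trans
      (AdjoinRoot.quotEquivQuotMap G 𝔪)
  haveI : Nontrivial ((IsLocalRing.ResidueField R)[X] ⧸ Ideal.span {Gbar}) := q.symm.toEquiv.nontrivial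
  haveI : IsLocalRing ((IsLocalRing.ResidueField R)[X] ⧸ Ideal.span {Gbar}) :=
    .of_surjective' (q.toRingEquiv.toRingHom) (fun y => ⟨q.symm y, by simp⟩)
  have hmk : (m : IsLocalRing.ResidueField R) ≠ 0 := natCast_residue_ne_zero K R hR hm
  have hsqf : Squarefree Gbar := by
    have hsep : (X ^ m - 1 : (IsLocalRing.ResidueField R)[X]).Separable := by
      simpa using Polynomial.separable_X_pow_sub_C (1 : IsLocalRing.ResidueField R) hmk one_ne_zero
    refine hsep.squarefree.squarefree_of_dvd ?_
    obtain ⟨H, hH⟩ := hdvd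
    refine ⟨H.map (IsLocalRing.residue R), ?_⟩
    rw [hGbar, ← Polynomial.map_mul, ← hH]
    simp
  haveI : IsReduced ((IsLocalRing.ResidueField R)[X] ⧸ Ideal.span {Gbar}) :=
    (Ideal.isRadical_iff_quotient_reduced _).mp (isRadical_iff_span_singleton.mp hsqf.isRadical)
  have hGbarmonic : Gbar.Monic := hGmonic.map _
  haveI : Module.Finite (IsLocalRing.ResidueField R) ((IsLocalRing.ResidueField R)[X] ⧸ Ideal.span {Gbar}) :=
    (AdjoinRoot.powerBasis' hGbarmonic).finite
  haveI : IsArtinianRing ((IsLocalRing.ResidueField R)[X] ⧸ Ideal.span {Gbar}) :=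
    IsArtinianRing.of_finite (IsLocalRing.ResidueField R) _
  exact IsArtinianRing.isField_of_isReduced_of_isLocalRing ((IsLocalRing.ResidueField R)[X] ⧸ Ideal.span {Gbar})

/-- **`K(ζ_m)/K` is unramified** (`e = 1`; Serre LF IV §4 Prop. 16: "the field `K_n` is an
unramified extension of `K`"): the maximal ideal of `O = R[ζ]` is generated by the maximal
ideal of `R`, because `O/𝔪_R O ≅ k[X]/(Ḡ)` is a field (`isField_residue_quot`).
[cite: SerreLocalFields1979, Ch. IV §4 Prop. 16] -/
theorem map_maximalIdeal_integralClosure_eq :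
    haveI := isLocalRing_integralClosure K L R hR
    (IsLocalRing.maximalIdeal R).map (algebraMap R (integralClosure R L)) =
      IsLocalRing.maximalIdeal (integralClosure R L) := by
  haveI := IsCyclotomicExtension.isGalois {m} K L
  haveI hloc := isLocalRing_integralClosure K L R hR
  letI := spectralNorm.normedField K L
  have hζi : IsIntegral R ζ := isIntegral_zeta K L R hζ
  set O := integralClosure R L with hOdef
  set G : R[X] := minpoly R ζ with hG
  set 𝔪 := IsLocalRing.maximalIdeal R with h𝔪
  set I : Ideal O := 𝔪.map (algebraMap R O) with hI
  have hOeq : O = Algebra.adjoin R {ζ} := integralClosure_eq_adjoin K L R hR hζ hm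
  let e : AdjoinRoot G ≃ₐ[R] O :=
    (minpoly.equivAdjoin hζi).trans (Subalgebra.equivOfEq _ _ hOeq.symm)
  have hcomp : (e : AdjoinRoot G →+* O).comp (AdjoinRoot.of G) = algebraMap R O :=
    RingHom.ext fun r => e.commutes r
  have hJ : I = (𝔪.map (AdjoinRoot.of G)).map (e : AdjoinRoot G →+* O) := by
    rw [Ideal.map_map, hcomp]
  let q : (O ⧸ I) ≃ₐ[R] ((IsLocalRing.ResidueField R)[X] ⧸ Ideal.span {G.map (IsLocalRing.residue R)}) :=
    (Ideal.quotientEquivAlg (𝔪.map (AdjoinRoot.of G)) I e hJ).symm.trans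
      (AdjoinRoot.quotEquivQuotMap G 𝔪)
  have hfieldO : IsField (O ⧸ I) :=
    (q : (O ⧸ I) ≃* _).isField (isField_residue_quot K L R hR hζ hm)
  exact IsLocalRing.eq_maximalIdeal (Ideal.Quotient.maximal_of_isField I hfieldO)

/-- If moreover the maximal ideal of `R` is generated by `π` (discretely valued `K`), every
nonzero `x ∈ L = K(ζ_m)` is `π ^ n · u` with `‖u‖ = 1`, i.e. `|L^×| = |K^×|` and `π` is a
uniformizer of `L` (Serre LF IV §4 Prop. 16, `K_n/K` unramified; with II §2 Cor. 2, uniqueness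
of the extended valuation, realised by the spectral norm).
[cite: SerreLocalFields1979, Ch. IV §4 Prop. 16] -/
theorem exists_eq_zpow_mul_of_norm_eq_one {π : K} (hπ : ‖π‖ < 1)
    (hπ' : ∀ a : K, ‖a‖ < 1 → ‖a‖ ≤ ‖π‖) {x : L} (hx : x ≠ 0) :
    ∃ n : ℤ, ∃ u : L, spectralNorm K L u = 1 ∧ x = algebraMap K L π ^ n * u := by
  haveI := IsCyclotomicExtension.isGalois {m} K L
  haveI hloc := isLocalRing_integralClosure K L R hR
  letI := spectralNorm.normedField K L
  have hsp : ∀ y : L, spectralNorm K L y = ‖y‖ := fun y => rfl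
  have hO : ∀ y : L, y ∈ integralClosure R L ↔ ‖y‖ ≤ 1 := fun y =>
    mem_integralClosure_iff_spectralNorm_le_one K L R hR
  set O := integralClosure R L with hOdef
  have hπ0 : π ≠ 0 := by
    rintro rfl
    obtain ⟨a, ha⟩ := NontriviallyNormedField.non_trivial (α := K)
    have ha0 : a ≠ 0 := fun h => by
      rw [h, norm_zero] at ha
      exact not_lt.mpr zero_le_one ha
    have h1 : ‖a⁻¹‖ < 1 := by
      rw [norm_inv]
      exact inv_lt_one_of_one_lt₀ ha
    have := hπ' _ h1
    rw [norm_zero] at this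
    exact (norm_pos_iff.mpr (inv_ne_zero ha0)).not_ge this
  have hπR : π ∈ R := (hR π).mpr hπ.le
  have hπL : ‖algebraMap K L π‖ = ‖π‖ := spectralNorm_extends π
  have hπL0 : algebraMap K L π ≠ 0 := by simpa using hπ0
  -- Step 1: elements of `O` of norm `< 1` are divisible by `π`
  have h𝔪 : IsLocalRing.maximalIdeal R = Ideal.span {(⟨π, hπR⟩ : R)} := by
    refine le_antisymm ?_ ?_
    · intro r hr
      rw [mem_maximalIdeal_valuationSubring_iff K R hR] at hr
      rw [Ideal.mem_span_singleton']
      by_cases hr0 : (r : K) = 0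
      · refine ⟨0, Subtype.ext ?_⟩
        simp [hr0]
      have hq : (r : K) / π ∈ R := by
        rw [hR, norm_div, div_le_one (norm_pos_iff.mpr hπ0)]
        exact hπ' _ hr
      refine ⟨⟨_, hq⟩, Subtype.ext ?_⟩
      change (r : K) / π * π = r
      rw [div_mul_cancel₀ _ hπ0]
    · rw [Ideal.span_le, Set.singleton_subset_iff, SetLike.mem_coe,
        mem_maximalIdeal_valuationSubring_iff K R hR]
      exact hπ
  have hdiv : ∀ z : O, ‖(z : L)‖ < 1 → ∃ z₁ : O, (z : L) = algebraMap K L π * z₁ := by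
    intro z hz
    have hzm : z ∈ IsLocalRing.maximalIdeal O :=
      (mem_maximalIdeal_integralClosure_iff K L R hR z).mpr hz
    rw [← map_maximalIdeal_integralClosure_eq K L R hR hζ hm, h𝔪, Ideal.map_span, Set.image_singleton,
      Ideal.mem_span_singleton'] at hzm
    obtain ⟨z₁, hz₁⟩ := hzm
    refine ⟨z₁, ?_⟩
    have := congrArg (fun w : O => (w : L)) hz₁
    simp only [Subalgebra.coe_mul] at this
    rw [← this, mul_comm]
    rfl
  -- Step 2: elements of `O` are `π ^ k · u`
  have hstep : ∀ n : ℕ, ∀ z : O, ‖π‖ ^ n < ‖(z : L)‖ →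
      ∃ k : ℕ, ∃ u : L, ‖u‖ = 1 ∧ (z : L) = algebraMap K L π ^ k * u := by
    intro n
    induction n with
    | zero =>
      intro z hz
      exact absurd ((hO _).mp z.2) (not_le.mpr (by simpa using hz))
    | succ n ih =>
      intro z hz
      rcases eq_or_lt_of_le ((hO _).mp z.2) with h1 | h1
      · exact ⟨0, z, h1, by simp⟩
      obtain ⟨z₁, hz₁⟩ := hdiv z h1
      have hz₁n : ‖π‖ ^ n < ‖(z₁ : L)‖ := by
        rw [hz₁, norm_mul, hπL, pow_succ'] at hz
        exact lt_of_mul_lt_mul_left hz (norm_nonneg _)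
      obtain ⟨k, u, hu, hk⟩ := ih z₁ hz₁n
      exact ⟨k + 1, u, hu, by rw [hz₁, hk, pow_succ']; ring⟩
  -- Step 3: scale `x` into `O`
  obtain ⟨j, hj⟩ : ∃ j : ℕ, ‖π‖ ^ j < ‖x‖⁻¹ :=
    exists_pow_lt_of_lt_one (inv_pos.mpr (norm_pos_iff.mpr hx)) hπ
  have hxO : algebraMap K L π ^ j * x ∈ O := by
    rw [hO, norm_mul, norm_pow, hπL]
    rw [lt_inv_comm₀ (pow_pos (norm_pos_iff.mpr hπ0) _) (norm_pos_iff.mpr hx)] at hj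
    calc ‖π‖ ^ j * ‖x‖ ≤ ‖π‖ ^ j * (‖π‖ ^ j)⁻¹ := by gcongr
      _ = 1 := mul_inv_cancel₀ (pow_ne_zero _ (norm_pos_iff.mpr hπ0).ne')
  have hxO0 : ‖((⟨_, hxO⟩ : O) : L)‖ ≠ 0 := by
    simp [hπL0, hx]
  obtain ⟨n, hn⟩ : ∃ n : ℕ, ‖π‖ ^ n < ‖((⟨_, hxO⟩ : O) : L)‖ :=
    exists_pow_lt_of_lt_one ((norm_nonneg _).lt_of_ne' hxO0) hπ
  obtain ⟨k, u, hu, hk⟩ := hstep n _ hn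
  refine ⟨(k : ℤ) - j, u, hu, ?_⟩
  change algebraMap K L π ^ j * x = algebraMap K L π ^ k * u at hk
  rw [zpow_sub₀ hπL0, zpow_natCast, zpow_natCast, div_mul_eq_mul_div, ← hk]
  field_simp

/-- **Norms from `K(ζ_m)` have valuation divisible by the degree**: every norm is
`a ^ [L:K] · c` with `a ∈ Kˣ`, `‖c‖ = 1` (Serre LF II §2 Cor. 4, `v(N x) = f · w(x)`, for the
unramified `K(ζ_m)/K` of IV §4 Prop. 16, where `f = [L : K]`).
[cite: SerreLocalFields1979, Ch. II §2 Cor. 4] -/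
theorem norm_eq_pow_mul_of_isCyclotomicExtension {π : K} (hπ : ‖π‖ < 1)
    (hπ' : ∀ a : K, ‖a‖ < 1 → ‖a‖ ≤ ‖π‖) {x : L} (hx : x ≠ 0) :
    ∃ a c : K, a ≠ 0 ∧ ‖c‖ = 1 ∧ Algebra.norm K x = a ^ Module.finrank K L * c := by
  obtain ⟨n, u, hu, rfl⟩ := exists_eq_zpow_mul_of_norm_eq_one K L R hR hζ hm hπ hπ' hx
  have hπ0 : π ≠ 0 := by
    rintro rfl
    obtain ⟨a, ha⟩ := NontriviallyNormedField.non_trivial (α := K)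
    have ha0 : a ≠ 0 := fun h => by
      rw [h, norm_zero] at ha
      exact not_lt.mpr zero_le_one ha
    have h1 : ‖a⁻¹‖ < 1 := by
      rw [norm_inv]
      exact inv_lt_one_of_one_lt₀ ha
    have := hπ' _ h1
    rw [norm_zero] at this
    exact (norm_pos_iff.mpr (inv_ne_zero ha0)).not_ge this
  refine ⟨π ^ n, Algebra.norm K u, zpow_ne_zero _ hπ0, ?_, ?_⟩
  · rw [norm_algebraNorm_eq_spectralNorm_pow, hu, one_pow]
  · rw [map_mul, ← map_zpow₀ (algebraMap K L), Algebra.norm_algebraMap]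

/-- **Residue degree** (Serre LF IV §4 Cor. 1 to Prop. 16, "`[K_n : K]` is the smallest
`r ≥ 1` with `q^r ≡ 1 mod n`", in the weak form `n ∣ q^{[K_n:K]} - 1`): for `L = K(ζ_m)` with
`‖m‖ = 1` and finite residue field `k` of `K` with `q` elements, `m ∣ q ^ [L : K] - 1` — the
residue field `k[X]/(Ḡ)` of `L` has `q ^ [L:K]` elements and contains a primitive `m`-th root
of unity. [cite: SerreLocalFields1979, Ch. IV §4 Cor. 1 to Prop. 16] -/
theorem dvd_card_residueField_pow_finrank_sub_one [Finite (IsLocalRing.ResidueField R)] :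
    m ∣ Nat.card (IsLocalRing.ResidueField R) ^ Module.finrank K L - 1 := by
  haveI := IsCyclotomicExtension.isGalois {m} K L
  have hζi : IsIntegral R ζ := isIntegral_zeta K L R hζ
  set G : R[X] := minpoly R ζ with hG
  have hGK : minpoly K ζ = G.map (algebraMap R K) :=
    minpoly.isIntegrallyClosed_eq_field_fractions' K hζi
  have hGmonic : G.Monic := minpoly.monic hζi
  set k := IsLocalRing.ResidueField R
  set Gbar : k[X] := G.map (IsLocalRing.residue R) with hGbar
  have hGbarmonic : Gbar.Monic := hGmonic.map _
  set k' := k[X] ⧸ Ideal.span {Gbar}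
  have hfield : IsField k' := isField_residue_quot K L R hR hζ hm
  haveI hmax : (Ideal.span {Gbar}).IsMaximal := Ideal.Quotient.maximal_of_isField _ hfield
  letI : Field k' := Ideal.Quotient.field _
  haveI : Module.Finite k k' := (AdjoinRoot.powerBasis' hGbarmonic).finite
  haveI : Finite k' := Module.finite_of_finite k
  -- degree bookkeeping: `[k' : k] = deg Ḡ = deg G = [L : K]`
  have hdeg : Module.finrank k k' = Module.finrank K L := by
    rw [finrank_quotient_span_eq_natDegree' hGbarmonic, hGbar, hGmonic.natDegree_map,
      (hζ.powerBasis K).finrank, IsPrimitiveRoot.powerBasis_dim, hGK, hGmonic.natDegree_map]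
  have hcard : Nat.card k' = Nat.card k ^ Module.finrank K L := by
    rw [← hdeg, Module.natCard_eq_pow_finrank (K := k) (V := k')]
  -- the image `θ` of `X` is a primitive `m`-th root of unity in the field `k'`
  have hmk : (m : k) ≠ 0 := natCast_residue_ne_zero K R hR hm
  haveI : NeZero (m : k) := ⟨hmk⟩
  haveI : NeZero (m : k') := NeZero.nat_of_injective (algebraMap k k').injective
  set θ : k' := AdjoinRoot.root Gbar with hθ
  have hGcyc : G ∣ cyclotomic m R := by
    rw [← Polynomial.map_dvd_map (algebraMap R K) (IsFractionRing.injective R K) hGmonic, ← hGK,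
      map_cyclotomic]
    haveI : NeZero (m : K) := ⟨fun h => by rw [h, norm_zero] at hm; exact zero_ne_one hm⟩
    haveI : NeZero (m : L) := NeZero.nat_of_injective (algebraMap K L).injective
    refine minpoly.dvd K ζ ?_
    rw [aeval_def, ← eval_map, map_cyclotomic]
    exact (isRoot_cyclotomic_iff.mpr hζ).eq_zero
  have hθroot : IsRoot (cyclotomic m k') θ := by
    obtain ⟨C', hC'⟩ := hGcyc
    have h0 : Gbar * C'.map (IsLocalRing.residue R) = cyclotomic m k := by
      rw [hGbar, ← Polynomial.map_mul, ← hC', map_cyclotomic]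
    set φ : k →+* k' := (Ideal.Quotient.mk (Ideal.span {Gbar})).comp C with hφ
    have h1 : cyclotomic m k' = Gbar.map φ * (C'.map (IsLocalRing.residue R)).map φ := by
      rw [← Polynomial.map_mul, h0, map_cyclotomic]
    rw [h1, IsRoot.def, eval_mul, show (Gbar.map φ).eval θ = 0 from ?_, zero_mul]
    rw [eval_map, hθ]
    change Gbar.eval₂ ((Ideal.Quotient.mk (Ideal.span {Gbar})).comp C)
      ((Ideal.Quotient.mk (Ideal.span {Gbar})) X) = 0
    rw [← Polynomial.hom_eval₂, eval₂_C_X, Ideal.Quotient.eq_zero_iff_mem]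
    exact Ideal.mem_span_singleton_self Gbar
  have hθ : IsPrimitiveRoot θ m := isRoot_cyclotomic_iff.mp hθroot
  -- its order `m` divides `|k'ˣ| = q ^ [L:K] - 1`
  obtain ⟨θu, hθu⟩ := hθ.isUnit (NeZero.ne m)
  have hθu' : IsPrimitiveRoot θu m := IsPrimitiveRoot.coe_units_iff.mp (hθu ▸ hθ)
  rw [← hcard, ← Nat.card_units, hθu'.eq_orderOf]
  exact orderOf_dvd_natCard θu

end Cyclotomic

/-! ### Specialisation to a non-archimedean local field -/

section LocalField

open ValuativeRel

variable (F : Type*) [Field F] [ValuativeRel F] [TopologicalSpace F] [IsNonarchimedeanLocalField F]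

omit [TopologicalSpace F] in
/-- A uniformizer of a non-archimedean local field: an element of valuation `< 1` that is
maximal among such (`𝒪[F]` is a discrete valuation ring). [folklore] -/
theorem exists_uniformizer_valuation [TopologicalSpace F] [IsNonarchimedeanLocalField F] :
    ∃ π : F, valuation F π < 1 ∧ ∀ a : F, valuation F a < 1 → valuation F a ≤ valuation F π := by
  obtain ⟨ϖ, hϖ⟩ := IsDiscreteValuationRing.exists_irreducible 𝒪[F]
  refine ⟨(ϖ : F), ?_, fun a ha => ?_⟩
  · exact Valuation.Integer.not_isUnit_iff_valuation_lt_one.mp hϖ.not_isUnit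
  · have ha1 : a ∈ 𝒪[F] := (Valuation.mem_integer_iff _ _).mpr ha.le
    have hau : ¬ IsUnit (⟨a, ha1⟩ : 𝒪[F]) :=
      Valuation.Integer.not_isUnit_iff_valuation_lt_one.mpr ha
    have hmem : (⟨a, ha1⟩ : 𝒪[F]) ∈ IsLocalRing.maximalIdeal 𝒪[F] := hau
    rw [hϖ.maximalIdeal_eq, Ideal.mem_span_singleton'] at hmem
    obtain ⟨b, hb⟩ := hmem
    have : a = (b : F) * ϖ := (congrArg Subtype.val hb).symm
    rw [this, map_mul]
    exact mul_le_of_le_one_left' b.2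

/-- **Norm groups of unramified extensions, containment half.**  For every `r ≥ 1` there is a
finite abelian extension `E ⊆ F̄` of the non-archimedean local field `F` — namely the
cyclotomic, unramified `E = F(ζ_{q^r-1})` — whose degree is divisible by `r` and all of whose
norms are `a ^ [E:F] · c` with `a ∈ Fˣ` and `c` a unit: `N(Eˣ) ⊆ v_F⁻¹([E:F]ℤ) ⊆ v_F⁻¹(rℤ)`.
Serre LF IV §4 Prop. 16 and Cor. 1 (`K_n/K` unramified of degree `ord_n(q)`, a multiple of `r`
for `n = q^r - 1`) with II §2 Cor. 4 (`v(N x) = f·w(x)`); cf. XIV §6 proof of Thm. 1, III-3,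
and V §2 Prop. 3 (c) for the full equality `N(Eˣ) = v⁻¹(fℤ)`, not proved here.
[cite: SerreLocalFields1979, Ch. IV §4 Prop. 16] -/
theorem exists_abelian_norm_eq_pow_mul (r : ℕ) (hr : 0 < r) :
    ∃ E : IntermediateField F (AlgebraicClosure F), FiniteDimensional F E ∧ IsAbelianGalois F E ∧
      r ∣ Module.finrank F E ∧ ∀ x : E, x ≠ 0 → ∃ a c : F, a ≠ 0 ∧ valuation F c = 1 ∧
        Algebra.norm F x = a ^ Module.finrank F E * c := by
  classical
  -- the normed structure on `F`
  letI : UniformSpace F := IsTopologicalAddGroup.rightUniformSpace F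
  haveI : IsUniformAddGroup F := isUniformAddGroup_of_addCommGroup
  letI hv1 : (Valued.v (R := F)).RankOne :=
  { hom' := IsRankLeOne.nonempty.some.emb (R := F).comp MonoidWithZeroHom.ValueGroup₀.embedding
    strictMono' := IsRankLeOne.nonempty.some.strictMono.comp
        MonoidWithZeroHom.ValueGroup₀.embedding_strictMono }
  letI hNF : NontriviallyNormedField F := Valued.toNontriviallyNormedField F (ValueGroupWithZero F)
  have hle : ∀ y : F, ‖y‖ ≤ 1 ↔ valuation F y ≤ 1 := fun y => by
    rw [Valued.toNormedField.norm_le_one_iff]; rfl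
  have hlt : ∀ y : F, ‖y‖ < 1 ↔ valuation F y < 1 := fun y => by
    rw [Valued.toNormedField.norm_lt_one_iff]; rfl
  have heq1 : ∀ y : F, ‖y‖ = 1 ↔ valuation F y = 1 := fun y => by
    rw [le_antisymm_iff, le_antisymm_iff, Valued.toNormedField.norm_le_one_iff,
      Valued.toNormedField.one_le_norm_iff]
    rfl
  have hlele : ∀ y y' : F, ‖y‖ ≤ ‖y'‖ ↔ valuation F y ≤ valuation F y' := fun y y' => by
    rw [Valued.toNormedField.norm_le_iff]; rfl
  -- the valuation ring and its (finite) residue field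
  set R : ValuationSubring F := (valuation F).valuationSubring with hRdef
  have hR : ∀ x : F, x ∈ R ↔ ‖x‖ ≤ 1 := fun x => by
    rw [hle]; exact Valuation.mem_valuationSubring_iff _ _
  haveI : Finite (IsLocalRing.ResidueField R) := inferInstanceAs (Finite 𝓀[F])
  set q : ℕ := Nat.card (IsLocalRing.ResidueField R) with hq
  have hq1 : 1 < q := Finite.one_lt_card
  have hqr : 1 < q ^ r := Nat.one_lt_pow hr.ne' hq1
  set m : ℕ := q ^ r - 1 with hm_def
  -- `‖q‖ < 1`, so `‖m‖ = ‖q ^ r - 1‖ = 1`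
  have hqF : ‖(q : F)‖ < 1 := by
    have h0 : (q : 𝓀[F]) = 0 := by
      letI := Fintype.ofFinite 𝓀[F]
      have := FiniteField.cast_card_eq_zero 𝓀[F]
      rwa [← Nat.card_eq_fintype_card] at this
    have h1 : ¬ IsUnit ((q : 𝒪[F])) := by
      intro hu
      have := (IsLocalRing.residue 𝒪[F]).isUnit_map hu
      rw [map_natCast, h0] at this
      exact not_isUnit_zero this
    rw [hlt]
    exact Valuation.Integer.not_isUnit_iff_valuation_lt_one.mp h1
  have hmF : ‖(m : F)‖ = 1 := by
    have hcast : (m : F) = (q : F) ^ r - 1 := by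
      rw [hm_def, Nat.cast_sub hqr.le, Nat.cast_pow, Nat.cast_one]
    have hqr' : ‖(q : F) ^ r‖ < 1 := by
      rw [norm_pow]; exact pow_lt_one₀ (norm_nonneg _) hqF hr.ne'
    rw [hcast]
    refine le_antisymm ?_ ?_
    · rw [sub_eq_add_neg]
      refine (IsUltrametricDist.norm_add_le_max _ _).trans ?_
      rw [norm_neg, norm_one]
      exact max_le hqr'.le le_rfl
    · have h := IsUltrametricDist.norm_add_le_max ((q : F) ^ r - 1) (-(q : F) ^ r)
      rw [show (q : F) ^ r - 1 + -(q : F) ^ r = -1 by ring, norm_neg, norm_one, norm_neg] at h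
      rcases le_max_iff.mp h with h | h
      · exact h
      · exact absurd h (not_le.mpr hqr')
  haveI : NeZero (m : F) := ⟨fun h => by rw [h, norm_zero] at hmF; exact zero_ne_one hmF⟩
  haveI : NeZero m := ⟨by omega⟩
  -- the cyclotomic extension `E = F(ζ_m) ⊆ F̄`
  obtain ⟨ζ, hζ⟩ := HasEnoughRootsOfUnity.exists_primitiveRoot (AlgebraicClosure F) m
  set E : IntermediateField F (AlgebraicClosure F) := IntermediateField.adjoin F {ζ} with hE
  haveI : IsCyclotomicExtension {m} F E := hζ.intermediateField_adjoin_isCyclotomicExtension F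
  haveI hfd : FiniteDimensional F E := IsCyclotomicExtension.finiteDimensional {m} F E
  have hab : IsAbelianGalois F E := IsCyclotomicExtension.isAbelianGalois {m} F E
  have hζE : IsPrimitiveRoot (⟨ζ, IntermediateField.mem_adjoin_simple_self F ζ⟩ : E) m :=
    IsPrimitiveRoot.coe_submonoidClass_iff.mp hζ
  -- a uniformizer
  obtain ⟨π, hπv, hπv'⟩ := exists_uniformizer_valuation F
  have hπ : ‖π‖ < 1 := (hlt π).mpr hπv
  have hπ' : ∀ a : F, ‖a‖ < 1 → ‖a‖ ≤ ‖π‖ := fun a ha =>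
    (hlele a π).mpr (hπv' a ((hlt a).mp ha))
  -- apply the general results
  have hdvd : m ∣ q ^ Module.finrank F E - 1 :=
    dvd_card_residueField_pow_finrank_sub_one F E R hR hζE hmF
  refine ⟨E, hfd, hab, ?_, fun x hx => ?_⟩
  · set d := Module.finrank F E with hd
    have h := Nat.pow_sub_one_gcd_pow_sub_one q r d
    rw [Nat.gcd_eq_left hdvd] at h
    have h' : q ^ r = q ^ Nat.gcd r d :=
      Nat.sub_one_cancel (by positivity) (by positivity) h
    have : r = Nat.gcd r d := Nat.pow_right_injective hq1 h'
    rw [this]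
    exact Nat.gcd_dvd_right r d
  · obtain ⟨a, c, ha, hc, h⟩ :=
      norm_eq_pow_mul_of_isCyclotomicExtension F E R hR hζE hmF hπ hπ' hx
    exact ⟨a, c, ha, (heq1 c).mp hc, h⟩

/-- **Axiom III-3, weak form (proved).**  Every finite-index subgroup `U` of `Fˣ` containing
the units `𝒪_Fˣ` *contains* a norm group (that of the unramified `F(ζ_{q^r-1})`, `r = [Fˣ:U]`:
its norms are `a^{[E:F]}·c ∈ (Fˣ)^r · 𝒪ˣ ⊆ U`).  Together with `isNormSubgroup_of_le` (Serre
XI §4 Prop. 4) this yields the printed III-3 (`isNormSubgroup_of_unitGroup_le`); for the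
existence theorem the weak form suffices (`localExistenceTheorem_of_reciprocity`).
Serre LF XIV §6, proof of Thm. 1, III-3 ("these groups are norm groups for unramified
extensions"). [cite: SerreLocalFields1979, Ch. XIV §6 Thm. 1 (proof, axiom III-3)] -/
theorem exists_isNormSubgroup_le_of_unitGroup_le (U : Subgroup Fˣ) [U.FiniteIndex]
    (hU : (valuation F).valuationSubring.unitGroup ≤ U) :
    ∃ N : Subgroup Fˣ, IsNormSubgroup F N ∧ N ≤ U := by
  obtain ⟨E, hfd, hab, ⟨k, hk⟩, hN⟩ := exists_abelian_norm_eq_pow_mul F U.index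
    (Nat.pos_of_ne_zero Subgroup.FiniteIndex.index_ne_zero)
  haveI := hfd
  haveI := hab
  refine ⟨_, isNormSubgroup_range F E, ?_⟩
  rintro _ ⟨x, rfl⟩
  obtain ⟨a, c, ha, hc, h⟩ := hN (x : E) x.ne_zero
  have hc0 : c ≠ 0 := fun h0 => by
    rw [h0, map_zero] at hc
    exact zero_ne_one hc
  have hx : Units.map (Algebra.norm F : E →* F) x =
      ((Units.mk0 a ha) ^ U.index) ^ k * Units.mk0 c hc0 := by
    ext
    simp [h, hk, pow_mul]
  rw [hx]
  exact U.mul_mem (U.pow_mem (U.pow_index_mem _) _)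
    (hU ((Valuation.mem_unitGroup_iff _ (valuation F) _).mpr hc))

end LocalField

/-! ### The existence theorem from the reciprocity-law facts alone -/

/-- **The existence theorem of local class field theory, reduced to the reciprocity-law block.**
Given: norm groups are stable under `⊓` (`h₁`, Serre XI §4 Prop. 4) and over-groups (`h₂`,
ibid.), universal norms are `n`-th powers (`h₃`, XI §5 Prop. 6 with XIV §6 III-2) and the norm
index equals the degree (`h₆`, XIII §4 Prop. 9) — every open finite-index `U ≤ Fˣ` is a norm
group; axioms III-1 (`isClosed_of_isNormSubgroup_holds`) and III-3 (weak form,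
`exists_isNormSubgroup_le_of_unitGroup_le`) are now theorems.  The proof is Serre's (XI §5
Thm. 2, as in `localExistenceTheorem_of`): `D_F ≤ U`; compactness of `𝒪ˣ ∖ U` against the
closed norm groups gives a norm group `N₀` with `N₀ ∩ 𝒪ˣ ⊆ U`; `V = 𝒪ˣ·(N₀ ∩ U)` has finite
index and contains `𝒪ˣ`, hence contains a norm group `V'`; `N₀ ∩ V' ⊆ U` and `N₀ ∩ V'` is a
norm group, so `U` is. [cite: SerreLocalFields1979, Ch. XIV §6 Thm. 1] -/
theorem localExistenceTheorem_of_reciprocity (F : Type*) [Field F] [ValuativeRel F]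
    [TopologicalSpace F] [IsNonarchimedeanLocalField F] (h₁ : isNormSubgroup_inf F)
    (h₂ : isNormSubgroup_of_le F) (h₃ : universalNormSubgroup_divisible_and_eq F)
    (h₆ : index_normSubgroup_eq_finrank F) : localExistenceTheorem F := by
  intro U hU hUfi
  classical
  have h₄ : isClosed_of_isNormSubgroup F := isClosed_of_isNormSubgroup_holds F
  set OU : Subgroup Fˣ := (valuation F).valuationSubring.unitGroup with hOU_def
  -- Step 1: universal norms lie in `U`.
  have hDU : universalNormSubgroup F ≤ U := universalNormSubgroup_le_of_finiteIndex h₃ U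
  -- Step 2: compactness of `𝒪ˣ ∖ U` against the closed norm groups.
  have hs : IsCompact ((OU : Set Fˣ) ∩ (U : Set Fˣ)ᶜ) :=
    (isCompact_unitGroup F).inter_right hU.isClosed_compl
  obtain ⟨u, hu⟩ := hs.elim_finite_subfamily_closed
    (fun i : {N : Subgroup Fˣ // IsNormSubgroup F N} => ((i.1 : Subgroup Fˣ) : Set Fˣ))
    (fun i => h₄ i.1 i.2) (by
      rw [Set.eq_empty_iff_forall_notMem]
      rintro x ⟨⟨-, hxU⟩, hxN⟩
      refine hxU (hDU ((mem_universalNormSubgroup_iff F x).mpr fun N hN => ?_))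
      exact Set.mem_iInter.mp hxN ⟨N, hN⟩)
  set N₀ : Subgroup Fˣ :=
    ⨅ i ∈ u, ((i : {N : Subgroup Fˣ // IsNormSubgroup F N}).1 : Subgroup Fˣ) with hN₀_def
  have hN₀ : IsNormSubgroup F N₀ := IsNormSubgroup.finset_iInf h₁ u _ fun i _ => i.2
  have hN₀U : ∀ x ∈ N₀, x ∈ OU → x ∈ U := by
    intro x hxN hxO
    by_contra hxU
    have hx : x ∈ ((OU : Set Fˣ) ∩ (U : Set Fˣ)ᶜ) ∩
        ⋂ i ∈ u, (((i : {N : Subgroup Fˣ // IsNormSubgroup F N}).1 : Subgroup Fˣ) : Set Fˣ) := by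
      refine ⟨⟨hxO, hxU⟩, Set.mem_iInter₂.mpr fun i hi => ?_⟩
      exact (Subgroup.mem_iInf.mp ((Subgroup.mem_iInf.mp hxN) i)) hi
    rw [hu] at hx
    exact hx
  haveI hN₀fi : N₀.FiniteIndex := hN₀.finiteIndex h₆
  -- Step 3: `V = 𝒪ˣ · (N₀ ∩ U)` has finite index and contains the units, hence contains a
  -- norm group `V'`.
  set V : Subgroup Fˣ := OU ⊔ (N₀ ⊓ U) with hV_def
  haveI hVfi : V.FiniteIndex := Subgroup.finiteIndex_of_le (le_sup_right : N₀ ⊓ U ≤ V)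
  obtain ⟨V', hV', hV'V⟩ := exists_isNormSubgroup_le_of_unitGroup_le F V le_sup_left
  -- Step 4: `N₀ ∩ V' ≤ N₀ ∩ V ≤ U`, and `N₀ ∩ V'` is a norm group.
  have hle : N₀ ⊓ V ≤ U := by
    intro x hx
    obtain ⟨hxN, hxV⟩ := Subgroup.mem_inf.mp hx
    obtain ⟨y, hy, z, hz, rfl⟩ := Subgroup.mem_sup.mp hxV
    obtain ⟨hzN, hzU⟩ := Subgroup.mem_inf.mp hz
    have hyN : y ∈ N₀ := by
      simpa using N₀.mul_mem hxN (N₀.inv_mem hzN)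
    exact U.mul_mem (hN₀U y hyN hy) hzU
  exact h₂ _ _ (h₁ _ _ hN₀ hV') ((inf_le_inf_left N₀ hV'V).trans hle)

/-- The trunk predicate `exists_intermediateField_normSubgroup_eq F` for a non-archimedean
local field `F`, from the reciprocity-law facts `h₁ h₂ h₃ h₆` alone (it is definitionally
`localExistenceTheorem F`). [cite: SerreLocalFields1979, Ch. XIV §6 Thm. 1] -/
theorem exists_intermediateField_normSubgroup_eq_of_reciprocity (F : Type*) [Field F]
    [ValuativeRel F] [TopologicalSpace F] [IsNonarchimedeanLocalField F]
    (h₁ : isNormSubgroup_inf F) (h₂ : isNormSubgroup_of_le F)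
    (h₃ : universalNormSubgroup_divisible_and_eq F) (h₆ : index_normSubgroup_eq_finrank F) :
    exists_intermediateField_normSubgroup_eq F :=
  localExistenceTheorem_of_reciprocity F h₁ h₂ h₃ h₆

end Literature.NumberTheory.GaloisRepresentations
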